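import Literature.MathematicalPhysics.QuantumFieldTheory.Balaban1983to89.B1Ineq225RegularRegion

/-!
# `Balaban1983to89.B1Ineq225DerivRegularRegion` — [Balaban1982Higgs1] Prop. 2.1 (2.25) p. 610, DERIVATIVE MEMBER («similarly the
# inequalities (1.10)») FOR BIG-BLOCK REGIONS `Ω ⊂ T_ε` UNDER `R₀` AT EVERY (2.23)-REGULAR FIELD ON THE (Higgs)₂,₃ CARRIER = [Balaban1983RegularityDecay]
# Theorem (1.10) derivative member `|(∇_A G)(y, y′)| ≤ C|y − y′|^{−d+1}e^{−δ₀|y−y′|}` for regions, carrier instance: the walk expansion with a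
# GENERAL PROBE `Φ` (any subadditive functional reading finitely many sites) and its instance `Φ(w) = |(D^ε_A w)(b)|`

statement-level skeleton of published theorems with citation tags; proofs where landed; nothing here is a claim about the Yang–Mills mass gap

PDF held: `paper:balaban1982-cmp85-higgs23-i` p. 610 [PDF 8]; `paper:balaban1983-cmp89-regularity-decay` pp. 572–573, 577–579 [PDF 2–3, 7–9] (text
layer re-read by this seat).

CITATION HEADER (lean-in-tree rule).  T. Bałaban, *(Higgs)₂,₃ quantum fields in a finite volume. I. A lower bound*, Commun. Math. Phys. **85**
(1982) 603–626 [Balaban1982Higgs1] (Prop. 2.1 (2.23), (2.25) p. 610) and T. Bałaban, *Regularity and decay of lattice Green's functions*, Commun.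
Math. Phys. **89** (1983) 571–597 [Balaban1983RegularityDecay] (Theorem (1.10) p. 573; (2.18)–(2.22) pp. 578–579; p. 579 «Thus the inequality (1.9) is proved, similarly the
inequalities (1.10)»).  Quotation docfix (self-audit after ref-4 gen 45 QUOTE-AUDIT-B1-p35, filed gen 13): the WHAT IS PRINTED block quotes only printed
sentences; no declaration changed.  Cell `lit-balaban` (HOME `run/shared/lean/pub/lit-balaban/`), Phase-2 proof seat **p35** gen 12 (unit `lit-balaban-p35`); SKELETON
rows **B1.Prop2.1** / **B1.Eq2.25** (derivative member, REGIONS of `T_ε` under `R₀`, concrete carrier) and **B4.Thm1.10(regions, carrier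
instance, derivative member)**.  USED BY NAME, never restated: this seat's `B1Ineq225RegionChain` (`nrmT`, `lpT_two_eq`, `cube_subset_of_near`),
`B1Ineq225RegularRegion` (`abs_acT_sub_le_of_reg_on`, `lpT_two_le_of_blockK`, `bOp_of_good`, `Gloc_of_good`, `rS_le_real`, `blockPiece`,
`sum_blockPiece`), `B1TorusRegionRop` (projected letters, `GP_eq`, `norm_GP_RopP_pow_apply_le`, `sNorm_RopP_pow_le`), `B1TorusLabelWalk`,
`B1TorusCubeLpInput.cube_inputs_lp`, `B1Lemma21RegularRegion.sNorm_bOp_le_of_bad`, gen 8/9's `B1TorusCubeBoxOp.cube_inputs`,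
`B1TorusCubeDerivInput.cube_input_deriv`, `B1TorusCubeDeriv.norm_covDeriv_hsmul_le`, r01's `B4Ineq110LpChain.lp_walk_bound_rem_exp`, r02's
`B2Restr216Lattice.norm_U_apply`, r14's `tdist_shift_le_one`, `tdist_blockIter_le_real`, `sum_exp_neg_tdist_le`.

WHAT IS PRINTED.  [B1] p. 610: *«Similarly we have |(D^η_{A,μ}G_k(Ω, A)f)(x)|, |(G_k(Ω, A)f)(x)| ≤ c₀exp(−δ₀dist(x, supp f))‖f‖_∞ (2.25) for x ∈ Ω,
dist(x, Ω^c) ≥ R₀.»*  [B4] p. 573: *«Similarly |(D^η_{A,μ}G_k(Ω, A)f)(x)|, |(G_k(Ω, A)f)(x)| ≤ c₀exp(−δ₀dist(x, supp f))‖f‖_∞ (1.10)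
for x ∈ Ω, dist(x, Ω^c) ≥ R₀.»*; p. 579: *«Thus the inequality (1.9) is proved, similarly the inequalities (1.10).»*

WHAT THIS FILE PROVES (kernel-checked, zero `sorry`; theorems only, no definition, no `Prop` fact).
* §1 **`chain_region_of_inputs_probe`** — the walk expansion of `B1Ineq225RegionChain.ineq225_value_region_of_inputs` for a GENERAL PROBE: a
  subadditive `Φ ≥`-functional with `Φ(0) ≤ 0` that vanishes on the letters `a_ig` of the cubes not seeing a finite probe set `X₀` and is bounded by
  `γ‖g‖_∞` on the letters of interior cubes; with `R₀` around every `x′ ∈ X₀`, `f` vanishing within `Dist` of `X₀` and a remainder hypothesis: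
  `Φ(G^ε_K(Ω, A)1_Ωf) ≤ 2·|X₀|2^d·γ·V·exp(−(Dist − 4rS)/(2M))·‖f‖_∞`.
* §2 the DERIVATIVE PROBE `Φ(w) = |(D^ε_A w)(⟨x, μ⟩)|`: additivity, locality (`covDeriv_aOp_eq_zero`), the tail `norm_covDeriv_tail_le` and the
  remainder (`exists_le_of_geometric`, `exists_deriv_tail_le`), and
  **`cube_deriv_sup`** — the (2.17) letters `‖G_j(h_jψ)‖_∞ ≤ C_γ(L^Kε)²‖ψ‖_∞`, `‖D^ε_A(h_jG_j(h_jψ))‖_∞ ≤ C_T(L^Kε)‖ψ‖_∞` at a cube under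
  (2.23) ON THAT CUBE (gen 11's `cube_inputs_reg` with the regularity hypothesis localised).
* §3 **`norm_covDeriv_propagatorK_region_reg_decay`** (`g` in a `K`-block) and **`norm_covDeriv_propagatorK_region_reg_decay_sum`** (arbitrary
  `g`) — PROP. 2.1 (2.25) DERIVATIVE MEMBER FOR BIG-BLOCK REGIONS UNDER `R₀` AT EVERY (2.23)-REGULAR `A`: with the data of
  `B1Ineq225RegularRegion.norm_propagatorK_region_reg_decay` and `{|y − x| ≤ 2rS + 2M(d+1) + 1} ⊂ Ω`:
  `‖(D^ε_A G^ε_K(Ω, A)1_Ωg)(⟨x, μ⟩)‖ ≤ c₁(K₀)(L^Kε)·exp(−D/(4K₀L^K))·M′` (one power of `L^Kε` less than the value member, as printed).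
HONEST SCOPE.  Derivative member in the operator form of gens 10–11 (not the kernel form with `|y − y′|^{−d+1}`); `Ω` a big-block union; `R₀` in
site form; (2.23) used on `Ω` only; (2.24) and (2.26) for regions remain separate rows.
Unit `lit-balaban-p35` gen 12 (literature-prover-lit-balaban-p35-g12-0).
-/

open scoped BigOperators

noncomputable section

namespace Literature.MathematicalPhysics.QuantumFieldTheory.Balaban1983to89.B1Ineq225DerivRegularRegion

open Literature.MathematicalPhysics.QuantumFieldTheory.Balaban1983to89.HiggsLattice
open Literature.MathematicalPhysics.QuantumFieldTheory.Balaban1983to89.HiggsAveraging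
open Literature.MathematicalPhysics.QuantumFieldTheory.Balaban1983to89.HiggsCovariance
open Literature.MathematicalPhysics.QuantumFieldTheory.Balaban1983to89.HiggsCovariancePos
open Literature.MathematicalPhysics.QuantumFieldTheory.Balaban1983to89.HiggsCovarianceCont (sNorm sNorm_nonneg sNorm_smul)
open Literature.MathematicalPhysics.QuantumFieldTheory.Balaban1983to89.B1TorusCubeCover
open Literature.MathematicalPhysics.QuantumFieldTheory.Balaban1983to89.B1TorusCubeLocality26 (rS cubeVec rS_succ_lt_half)
open Literature.MathematicalPhysics.QuantumFieldTheory.Balaban1983to89.B1TorusCubeChart (dd castD toT M2 predL_succ)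
open Literature.MathematicalPhysics.QuantumFieldTheory.Balaban1983to89.B1TorusCubeBoxOp (acT cube_inputs)
open Literature.MathematicalPhysics.QuantumFieldTheory.Balaban1983to89.B1TorusCubeDerivInput (cube_input_deriv)
open Literature.MathematicalPhysics.QuantumFieldTheory.Balaban1983to89.B1TorusCubeDeriv (norm_covDeriv_hsmul_le)
open Literature.MathematicalPhysics.QuantumFieldTheory.Balaban1983to89.B4Lemma22ReduceZero (Box)
open Literature.MathematicalPhysics.QuantumFieldTheory.Balaban1983to89.B4Lower18Regular (e1)
open Literature.MathematicalPhysics.QuantumFieldTheory.Balaban1983to89.B4Lemma22EtaBox (vol vol_pos)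
open Literature.MathematicalPhysics.QuantumFieldTheory.Balaban1983to89.B4PartitionUnity22 (hprof D1 D2 D1_nonneg D2_nonneg contDiff_hprof
  hasCompactSupport_hprof)
open Literature.MathematicalPhysics.QuantumFieldTheory.Balaban1983to89.B1TorusRegionCubes
open Literature.MathematicalPhysics.QuantumFieldTheory.Balaban1983to89.B1TorusRegionHSizes (IsBigBlockUnion blockSat_of_isBigBlockUnion)
open Literature.MathematicalPhysics.QuantumFieldTheory.Balaban1983to89.B1TorusRegionRop
open Literature.MathematicalPhysics.QuantumFieldTheory.Balaban1983to89.B1TorusLabelWalk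
open Literature.MathematicalPhysics.QuantumFieldTheory.Balaban1983to89.B1Lemma21RegularRegion (sNorm_bOp_le_of_bad)
open Literature.MathematicalPhysics.QuantumFieldTheory.Balaban1983to89.B1TorusCubeLpInput (lpT lpT_def lpT_nonneg cube_inputs_lp)
open Literature.MathematicalPhysics.QuantumFieldTheory.Balaban1983to89.B1Ineq225RegionChain
open Literature.MathematicalPhysics.QuantumFieldTheory.Balaban1983to89.B1Ineq225RegularRegion
open Literature.MathematicalPhysics.QuantumFieldTheory.Balaban1983to89.B1Ineq225DecayBackgroundTorus (tdist_le_of_near)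
open Literature.MathematicalPhysics.QuantumFieldTheory.Balaban1983to89.B1Ineq234LevelZero (tdist_triangle_real tdist_shift_le_one)
open Literature.MathematicalPhysics.QuantumFieldTheory.Balaban1983to89.B1Ineq234Concrete (tdist_blockIter_le_real)
open Literature.MathematicalPhysics.QuantumFieldTheory.Balaban1983to89.B1Ineq18RegularRegion (gammaReg_pos)
open Literature.MathematicalPhysics.QuantumFieldTheory.Balaban1983to89.B2Restr216Lattice (norm_U_apply)
open Literature.MathematicalPhysics.QuantumFieldTheory.Balaban1983to89.B2Eq230CondShiftBound (sum_exp_neg_tdist_le)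
open Literature.MathematicalPhysics.QuantumFieldTheory.Balaban1983to89.B4Sect5Proof (latticeConst latticeConst_nonneg)
open Literature.MathematicalPhysics.QuantumFieldTheory.Balaban1983to89.B4RandomWalk213 (IsWalk lastPt)
open Literature.MathematicalPhysics.QuantumFieldTheory.Balaban1983to89.B4Ineq110LpChain (lp_walk_bound_rem_exp)

variable {P : HiggsLattice.Params} {N : ℕ}

/-! ## §1 The walk expansion for a general probe -/

section Probe

variable (C : ChargeData N) {K K₀ : ℕ} (Ω : Finset (HiggsLattice.Site P 0)) (A : HiggsLattice.VecField P 0) {msq a : ℝ}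

set_option maxHeartbeats 800000 in
/-- **THE WALK EXPANSION (2.12)–(2.22) FOR A REGION WITH A GENERAL PROBE `Φ`** («similarly the inequalities (1.10)»): as
`B1Ineq225RegionChain.ineq225_value_region_of_inputs`, with the evaluation `w ↦ |w(x)|` replaced by any `Φ` with `Φ(0) ≤ 0`,
`Φ(u + v) ≤ Φ(u) + Φ(v)`, `Φ(a_ig) ≤ 0` for the cubes `□_i` whose `rS`-core misses the finite probe set `X₀`, and `Φ(a_ig) ≤ γ‖g‖_∞` at interior
cubes; `R₀` around every point of `X₀`, `f` vanishing within `Dist` of `X₀`, and the remainder hypothesis `Φ((G1_Ω)(R1_Ω)^m f) → 0`.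
[cite: Balaban1983RegularityDecay, (2.18)–(2.22) pp.578–579, p.579 «similarly the inequalities (1.10)»] [cite: Balaban1982Higgs1, Prop. 2.1 (2.25) p.610] -/
theorem chain_region_of_inputs_probe (hK : K ≤ P.K) (hK₀ : K₀ ∣ P.M) (hK₀8 : 8 ≤ K₀)
    (hN3 : ∀ μ, 3 * half P K K₀ ≤ P.sitesPerDir 0 μ) (hΩ : IsBigBlockUnion K K₀ Ω) (hmsq : 0 < msq) (hak : 0 ≤ B1.aSeq a P.L K)
    {n₀ : ℕ} (hn₀ : 1 ≤ n₀) {γ β : ℝ} (hγ : 0 ≤ γ) (hβ : 0 ≤ β) (hDβ : (3 : ℝ) ^ P.d * β ≤ Real.exp (-1))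
    {Φ : HiggsLattice.ScalarField P 0 N → ℝ} (hΦ0 : Φ 0 ≤ 0) (hΦadd : ∀ u v, Φ (u + v) ≤ Φ u + Φ v)
    (X₀ : Finset (HiggsLattice.Site P 0))
    (hΦloc : ∀ i : Lab P K K₀, (∀ x' ∈ X₀, ¬ Near K K₀ (rS P K K₀) i x') → ∀ g : HiggsLattice.ScalarField P 0 N,
      Φ (aOp C K K₀ Ω A msq a i g) ≤ 0)
    (hΦa : ∀ i : Lab P K K₀, cube K K₀ i ⊆ Ω → ∀ g : HiggsLattice.ScalarField P 0 N, Φ (aOp C K K₀ Ω A msq a i g) ≤ γ * ‖g‖)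
    (h0 : ∀ j : Lab P K K₀, cube K K₀ j ⊆ Ω → ∀ ψ : HiggsLattice.ScalarField P 0 N, ‖bOp C K K₀ Ω A msq a j ψ‖ ≤ β * ‖ψ‖)
    (hgr : ∀ j : Lab P K K₀, cube K K₀ j ⊆ Ω → ∀ p q : ℝ, 1 ≤ p → p ≤ q → p⁻¹ - q⁻¹ ≤ (2 * n₀ : ℝ)⁻¹ →
      ∀ ψ : HiggsLattice.ScalarField P 0 N, lpT K q (bOp C K K₀ Ω A msq a j ψ) ≤ β * lpT K p ψ)
    (hps : ∀ j : Lab P K K₀, cube K K₀ j ⊆ Ω → ∀ ψ : HiggsLattice.ScalarField P 0 N,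
      ‖bOp C K K₀ Ω A msq a j ψ‖ ≤ β * lpT K (2 * n₀) ψ)
    (h2 : ∀ (j : Lab P K K₀) (ψ : HiggsLattice.ScalarField P 0 N), (∀ y, y ∉ Ω → ψ y = 0) →
      sNorm (bOp C K K₀ Ω A msq a j ψ) ≤ β * sNorm ψ)
    (hR : ∀ x' ∈ X₀, ∀ y, HiggsLattice.Site.tdist x' y ≤ 2 * rS P K K₀ + 2 * half P K K₀ * (n₀ + 1) → y ∈ Ω)
    (f : HiggsLattice.ScalarField P 0 N) {Dist : ℕ} (hf : ∀ x' ∈ X₀, ∀ y, f y ≠ 0 → Dist ≤ HiggsLattice.Site.tdist x' y)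
    {V : ℝ} (hV : 1 ≤ V) (hfV : lpT K 2 f ≤ V * ‖f‖)
    (hrem : ∀ ε' : ℝ, 0 < ε' → ∃ m : ℕ, Φ ((GP C K Ω A msq a * RopP C K K₀ Ω A msq a ^ m) f) ≤ ε') :
    Φ (propagatorK C Ω A msq a K (chi Ω • f))
      ≤ 2 * (X₀.card * 2 ^ P.d) * γ * V * Real.exp (-(((Dist : ℝ) - 4 * rS P K K₀) / (2 * half P K K₀))) * ‖f‖ := by
  classical
  have hK₀' : 1 ≤ K₀ := le_trans (by norm_num) hK₀8
  have hh : 0 < (half P K K₀ : ℝ) := by exact_mod_cast half_pos hK₀'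
  have hΩb := blockSat_of_isBigBlockUnion (K₀ := K₀) hK hΩ
  have hn₀0 : n₀ ≠ 0 := by omega
  have hn₀r : (0 : ℝ) < n₀ := by exact_mod_cast hn₀
  -- the sets `S₀`, `S₁` and the separation count `N`
  set S₀ : Finset (Lab P K K₀) := Finset.univ.filter fun i => ∃ x' ∈ X₀, Near K K₀ (rS P K K₀) i x' with hS₀
  set S₁ : Finset (Lab P K K₀) := Finset.univ.filter fun l => ∃ y, f y ≠ 0 ∧ Near K K₀ (rS P K K₀) l y with hS₁
  set Nn : ℕ := ⌈((Dist : ℝ) - 4 * rS P K K₀) / (2 * half P K K₀)⌉₊ with hNn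
  have hgoodS₀ : ∀ i ∈ S₀, cube K K₀ i ⊆ Ω := fun i hi => by
    rw [hS₀, Finset.mem_filter] at hi
    obtain ⟨x', hx', hnear⟩ := hi.2
    refine cube_subset_of_near (hR x' hx') ?_ hnear
    nlinarith [Nat.zero_le (half P K K₀)]
  have hS₀card : (S₀.card : ℝ) ≤ X₀.card * 2 ^ P.d := by
    have hsub : S₀ ⊆ X₀.biUnion fun x' => Finset.univ.filter fun i : Lab P K K₀ => Near K K₀ (rS P K K₀) i x' := by
      intro i hi
      rw [hS₀, Finset.mem_filter] at hi
      obtain ⟨x', hx', hnear⟩ := hi.2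
      rw [Finset.mem_biUnion]
      exact ⟨x', hx', by rw [Finset.mem_filter]; exact ⟨Finset.mem_univ _, hnear⟩⟩
    have h1 := (Finset.card_le_card hsub).trans Finset.card_biUnion_le
    have h2 : ∑ x' ∈ X₀, (Finset.univ.filter fun i : Lab P K K₀ => Near K K₀ (rS P K K₀) i x').card ≤ ∑ _x' ∈ X₀, 2 ^ P.d :=
      Finset.sum_le_sum fun x' _ => card_filter_near_rS_le hK hK₀ hK₀8 x'
    rw [Finset.sum_const, smul_eq_mul] at h2
    exact_mod_cast h1.trans h2
  -- the abstract chain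
  have hmain := lp_walk_bound_rem_exp (R := Module.End ℝ (HiggsLattice.ScalarField P 0 N)) (E := HiggsLattice.ScalarField P 0 N)
    (LAdj K K₀) (a := aOpP C K K₀ Ω A msq a) (b := bOpP C K K₀ Ω A msq a)
    (G := GP C K Ω A msq a) (G₀ := G0P C K K₀ Ω A msq a) (Rop := RopP C K K₀ Ω A msq a) (f := f)
    (Φ := Φ) (nrm := nrmT K n₀) (good := fun j : Lab P K K₀ => cube K K₀ j ⊆ Ω)
    (S₀ := S₀) (S₁ := S₁) (c₁ := γ) (β := β) (r := (Nn : ℝ) + 2) (D := 3 ^ P.d) (N := Nn) (n₀ := n₀) (V := V)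
    G0P_eq_sum RopP_eq_sum (GP_eq C Ω A hK hK₀ hK₀8 hN3 hΩb hmsq hak)
    hrem
    (fun i l hil => aOpP_mul_bOpP_eq_zero C Ω A hK hK₀ hK₀8 hN3 hΩb hmsq hak i l fun y hy =>
      hil (ladj_of_near_near hK hK₀ hK₀8 hy.1 hy.2))
    (fun i l hil => bOpP_mul_bOpP_eq_zero C Ω A hK hK₀ hK₀8 hN3 hΩb hmsq hak i l fun y hy =>
      hil (ladj_of_near_near hK hK₀ hK₀8 hy.1 hy.2))
    hΦ0 hΦadd
    (fun i hi g => hΦloc i (fun x' hx' hn => hi (by rw [hS₀, Finset.mem_filter]; exact ⟨Finset.mem_univ _, x', hx', hn⟩)) _)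
    (fun i hi => by
      show aOpP C K K₀ Ω A msq a i f = 0
      rw [aOpP_apply]
      refine aOp_apply_eq_zero_of_support C Ω A msq a hK hK₀ hK₀8 i _ fun z hz hzn => hi ?_
      rw [hS₁, Finset.mem_filter]
      refine ⟨Finset.mem_univ _, z, fun hf0 => hz ?_, hzn⟩
      rw [chi_smul_apply]; split_ifs <;> simp [hf0])
    (fun i hi => by
      show bOpP C K K₀ Ω A msq a i f = 0
      rw [bOpP_apply]
      refine bOp_apply_eq_zero_of_support C Ω A msq a hK hK₀ hK₀8 i _ fun z hz hzn => hi ?_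
      rw [hS₁, Finset.mem_filter]
      refine ⟨Finset.mem_univ _, z, fun hf0 => hz ?_, hzn⟩
      rw [chi_smul_apply]; split_ifs <;> simp [hf0])
    hγ
    (fun i hi g => by
      show Φ (aOpP C K K₀ Ω A msq a i g) ≤ γ * nrmT K n₀ 0 g
      rw [aOpP_apply, nrmT_zero]
      exact (hΦa i (hgoodS₀ i hi) _).trans (mul_le_mul_of_nonneg_left (norm_chi_smul_le Ω g) hγ))
    hβ
    (fun j hj i hi1 hin g => by
      show nrmT K n₀ (i - 1) (bOpP C K K₀ Ω A msq a j g) ≤ β * nrmT K n₀ i g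
      rw [bOpP_apply, nrmT_of_ne_zero n₀ (by omega : i ≠ 0)]
      rcases Nat.lt_or_ge 1 i with hi2 | hi2
      · -- grades `i − 1 ≥ 1`: the (p, q) letter with `1/p − 1/q = 1/(2n₀)`
        rw [nrmT_of_ne_zero n₀ (by omega : i - 1 ≠ 0)]
        have hir : (1 : ℝ) < i := by exact_mod_cast hi2
        have hi0 : (0 : ℝ) < i := by linarith
        have him : (0 : ℝ) < (i : ℝ) - 1 := by linarith
        have hcast : (((i - 1 : ℕ)) : ℝ) = (i : ℝ) - 1 := by rw [Nat.cast_sub (by omega), Nat.cast_one]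
        rw [hcast]
        have hp1 : (1 : ℝ) ≤ 2 * n₀ / i := by
          rw [le_div_iff₀ hi0, one_mul]
          have : (i : ℝ) ≤ n₀ := by exact_mod_cast hin
          linarith
        have hpq : (2 * n₀ / i : ℝ) ≤ 2 * n₀ / ((i : ℝ) - 1) :=
          div_le_div_of_nonneg_left (by positivity) him (by linarith)
        have hdiff : (2 * n₀ / i : ℝ)⁻¹ - (2 * n₀ / ((i : ℝ) - 1))⁻¹ ≤ (2 * n₀ : ℝ)⁻¹ := by
          rw [inv_div, inv_div]
          have : (i : ℝ) / (2 * n₀) - ((i : ℝ) - 1) / (2 * n₀) = (2 * n₀ : ℝ)⁻¹ := by field_simp; ring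
          rw [this]
        exact (hgr j hj _ _ hp1 hpq hdiff (chi Ω • g)).trans
          (mul_le_mul_of_nonneg_left (lpT_chi_smul_le Ω (by positivity) g) hβ)
      · -- grade `0` from grade `1`: the (p₁, ∞) letter
        have hi1' : i = 1 := by omega
        subst hi1'
        rw [show (1 - 1 : ℕ) = 0 from rfl, nrmT_zero, Nat.cast_one, div_one]
        exact (hps j hj (chi Ω • g)).trans (mul_le_mul_of_nonneg_left (lpT_chi_smul_le Ω (by positivity) g) hβ))
    (fun j g => by
      show nrmT K n₀ n₀ (bOpP C K K₀ Ω A msq a j g) ≤ β * nrmT K n₀ n₀ g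
      rw [bOpP_apply, nrmT_top hn₀0, nrmT_top hn₀0, lpT_two_eq, lpT_two_eq]
      have hc := cTwo_pos P K
      calc (vol (dd P) (P.L - 1) K)⁻¹ ^ (2 : ℝ)⁻¹ * (Real.sqrt (P.mesh 0 ^ P.d))⁻¹ * sNorm (bOp C K K₀ Ω A msq a j (chi Ω • g))
          ≤ (vol (dd P) (P.L - 1) K)⁻¹ ^ (2 : ℝ)⁻¹ * (Real.sqrt (P.mesh 0 ^ P.d))⁻¹ * (β * sNorm (chi Ω • g)) :=
            mul_le_mul_of_nonneg_left (h2 j _ (chi_smul_supported Ω g)) hc.le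
        _ ≤ (vol (dd P) (P.L - 1) K)⁻¹ ^ (2 : ℝ)⁻¹ * (Real.sqrt (P.mesh 0 ^ P.d))⁻¹ * (β * sNorm g) :=
            mul_le_mul_of_nonneg_left (mul_le_mul_of_nonneg_left (sNorm_chi_smul_le Ω g) hβ) hc.le
        _ = β * ((vol (dd P) (P.L - 1) K)⁻¹ ^ (2 : ℝ)⁻¹ * (Real.sqrt (P.mesh 0 ^ P.d))⁻¹ * sNorm g) := by ring)
    (fun j hj g => by
      show nrmT K n₀ 0 (bOpP C K K₀ Ω A msq a j g) ≤ β * nrmT K n₀ 0 g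
      rw [bOpP_apply, nrmT_zero, nrmT_zero]
      exact (h0 j hj _).trans (mul_le_mul_of_nonneg_left (norm_chi_smul_le Ω g) hβ))
    hV
    (by rw [nrmT_top hn₀0, nrmT_zero]; exact hfV)
    (by rw [nrmT_zero]; exact norm_nonneg f)
    (fun n i hi ys hw t ht => by
      rw [hS₀, Finset.mem_filter] at hi
      obtain ⟨x', hx', hnear⟩ := hi.2
      refine cube_subset_of_walk hK hK₀ (hR x' hx') hw hnear t ?_
      have : (t : ℕ) + 2 ≤ n₀ + 1 := by omega
      nlinarith [Nat.zero_le (half P K K₀)])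
    (fun j => card_filter_ladj_le hK hK₀ hK₀' j)
    (by rw [Nat.cast_pow, Nat.cast_ofNat]; exact hDβ)
    (fun n i hi ys hw hl => by
      rw [hS₀, Finset.mem_filter] at hi
      rw [hS₁, Finset.mem_filter] at hl
      obtain ⟨x', hx', hnear⟩ := hi.2
      obtain ⟨y, hy, hyn⟩ := hl.2
      have hd := tdist_le_of_walk_near hK hK₀ hw hnear hyn
      have hD := hf x' hx' y hy
      rw [hNn]
      refine Nat.ceil_le.2 ?_
      rw [div_le_iff₀ (by positivity)]
      have : ((Dist : ℕ) : ℝ) ≤ 4 * rS P K K₀ + 2 * half P K K₀ * n := by exact_mod_cast hD.trans hd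
      linarith)
    (by linarith)
  -- read off the bound
  have hΦ : Φ (propagatorK C Ω A msq a K (chi Ω • f)) = Φ (GP C K Ω A msq a • f) := rfl
  rw [hΦ]
  refine hmain.trans ?_
  rw [nrmT_zero]
  have hexp : Real.exp 2 * Real.exp (-((Nn : ℝ) + 2)) ≤ Real.exp (-(((Dist : ℝ) - 4 * rS P K K₀) / (2 * half P K K₀))) := by
    rw [← Real.exp_add]
    refine Real.exp_le_exp.2 ?_
    have := Nat.le_ceil (((Dist : ℝ) - 4 * rS P K K₀) / (2 * half P K K₀))
    rw [← hNn] at this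
    linarith
  have hVf : 0 ≤ V * ‖f‖ := mul_nonneg (zero_le_one.trans hV) (norm_nonneg f)
  calc 2 * (S₀.card : ℝ) * γ * V * Real.exp 2 * Real.exp (-((Nn : ℝ) + 2)) * ‖f‖
      = (S₀.card : ℝ) * (Real.exp 2 * Real.exp (-((Nn : ℝ) + 2))) * (2 * γ * (V * ‖f‖)) := by ring
    _ ≤ (X₀.card * 2 ^ P.d) * Real.exp (-(((Dist : ℝ) - 4 * rS P K K₀) / (2 * half P K K₀))) * (2 * γ * (V * ‖f‖)) :=
        mul_le_mul_of_nonneg_right (mul_le_mul hS₀card hexp (by positivity) (by positivity)) (by positivity)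
    _ = 2 * (X₀.card * 2 ^ P.d) * γ * V * Real.exp (-(((Dist : ℝ) - 4 * rS P K K₀) / (2 * half P K K₀))) * ‖f‖ := by ring


end Probe

/-! ## §2 The derivative probe and the derivative letters at interior cubes -/

section DerivProbe

variable (C : ChargeData N) {K K₀ : ℕ} (Ω : Finset (HiggsLattice.Site P 0)) (A : HiggsLattice.VecField P 0) {msq a : ℝ}

/-- `D^ε_A` is additive in the field. [cite: Balaban1982Higgs1, (1.7) p.605] -/
theorem covDeriv_add' (u v : HiggsLattice.ScalarField P 0 N) (b : HiggsLattice.PBond P 0) :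
    covDeriv C A (u + v) b = covDeriv C A u b + covDeriv C A v b := by
  unfold covDeriv
  rw [Pi.add_apply, Pi.add_apply, map_add, ← smul_add]
  congr 1
  abel

/-- `D^ε_A 0 = 0`. [cite: Balaban1982Higgs1, (1.7) p.605] -/
theorem covDeriv_zero' (b : HiggsLattice.PBond P 0) : covDeriv C A (0 : HiggsLattice.ScalarField P 0 N) b = 0 := by
  unfold covDeriv
  simp

/-- `D^ε_A` of a finite sum. [cite: Balaban1982Higgs1, (1.7) p.605] -/
theorem covDeriv_sum' {ι : Type*} (s : Finset ι) (w : ι → HiggsLattice.ScalarField P 0 N) (b : HiggsLattice.PBond P 0) :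
    covDeriv C A (∑ i ∈ s, w i) b = ∑ i ∈ s, covDeriv C A (w i) b := by
  classical
  induction s using Finset.induction_on with
  | empty => rw [Finset.sum_empty, Finset.sum_empty, covDeriv_zero']
  | insert i s hi ih => rw [Finset.sum_insert hi, Finset.sum_insert hi, covDeriv_add', ih]

/-- `|D^ε_A w(b)| ≤ ε^{−1}(|w(b₊)| + |w(b₋)|)` (`|U| = 1`). [cite: Balaban1982Higgs1, (1.7) p.605] -/
theorem norm_covDeriv_le (w : HiggsLattice.ScalarField P 0 N) (b : HiggsLattice.PBond P 0) :
    ‖covDeriv C A w b‖ ≤ (P.mesh 0)⁻¹ * (‖w b.tgt‖ + ‖w b.src‖) := by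
  unfold covDeriv
  rw [norm_smul, Real.norm_eq_abs, abs_of_pos (inv_pos.2 (P.mesh_pos 0))]
  refine mul_le_mul_of_nonneg_left ((norm_sub_le _ _).trans (by rw [norm_U_apply])) (inv_nonneg.2 (P.mesh_pos 0).le)

/-- **LOCALITY OF THE DERIVATIVE PROBE**: `D^ε_A(a_ig)(⟨x, μ⟩) = 0` when neither `x` nor `x + e_μ` is within `rS` of `Mi`.
[cite: Balaban1983RegularityDecay, (2.13) p.577] -/
theorem covDeriv_aOp_eq_zero (hK : K ≤ P.K) (hK₀ : K₀ ∣ P.M) (hK₀8 : 8 ≤ K₀) (i : Lab P K K₀) (g : HiggsLattice.ScalarField P 0 N)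
    {x : HiggsLattice.Site P 0} {μ : Fin P.d} (hx : ¬ Near K K₀ (rS P K K₀) i x) (hx' : ¬ Near K K₀ (rS P K K₀) i (x.shift μ)) :
    covDeriv C A (aOp C K K₀ Ω A msq a i g) ⟨x, μ⟩ = 0 := by
  have h1 : aOp C K K₀ Ω A msq a i g ((⟨x, μ⟩ : HiggsLattice.PBond P 0).tgt) = 0 :=
    aOp_apply_eq_zero_off C Ω A msq a hK hK₀ hK₀8 i g hx'
  have h2 : aOp C K K₀ Ω A msq a i g ((⟨x, μ⟩ : HiggsLattice.PBond P 0).src) = 0 :=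
    aOp_apply_eq_zero_off C Ω A msq a hK hK₀ hK₀8 i g hx
  unfold covDeriv
  rw [h1, h2, map_zero, sub_zero, smul_zero]

/-- **THE TAIL OF (2.12) UNDER THE DERIVATIVE**: `|D^ε_A((G1_Ω)(R1_Ω)^m g)(b)| ≤ (2^dβ)^m·ε^{−1}·2ε^{−d/2}m⁻²|g|`, uniformly in the bond
(both end-point values are bounded by `B1TorusRegionRop.norm_GP_RopP_pow_apply_le`, `|U| = 1`). [cite: Balaban1983RegularityDecay, (2.12) p.577] -/
theorem norm_covDeriv_tail_le (hK : K ≤ P.K) (hK₀ : K₀ ∣ P.M) (hK₀8 : 8 ≤ K₀) (hmsq : 0 < msq) (hak : 0 ≤ B1.aSeq a P.L K)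
    {β : ℝ} (hβ : 0 ≤ β)
    (hb : ∀ (j : Lab P K K₀) (φ : HiggsLattice.ScalarField P 0 N), (∀ x, x ∉ Ω → φ x = 0) →
      sNorm (bOp C K K₀ Ω A msq a j φ) ≤ β * sNorm φ)
    (m : ℕ) (g : HiggsLattice.ScalarField P 0 N) (b : HiggsLattice.PBond P 0) :
    ‖covDeriv C A ((GP C K Ω A msq a * RopP C K K₀ Ω A msq a ^ m) g) b‖
      ≤ (2 ^ P.d * β) ^ m * ((P.mesh 0)⁻¹ * (2 * ((Real.sqrt (P.mesh 0 ^ P.d))⁻¹ * msq⁻¹ * sNorm g))) := by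
  have ht := norm_GP_RopP_pow_apply_le C Ω A hK hK₀ hK₀8 hmsq hak hβ hb m g b.tgt
  have hs := norm_GP_RopP_pow_apply_le C Ω A hK hK₀ hK₀8 hmsq hak hβ hb m g b.src
  refine (norm_covDeriv_le C A _ b).trans ?_
  have hm := P.mesh_pos 0
  calc (P.mesh 0)⁻¹ * (‖(GP C K Ω A msq a * RopP C K K₀ Ω A msq a ^ m) g b.tgt‖
        + ‖(GP C K Ω A msq a * RopP C K K₀ Ω A msq a ^ m) g b.src‖)
      ≤ (P.mesh 0)⁻¹ * (2 * ((Real.sqrt (P.mesh 0 ^ P.d))⁻¹ * msq⁻¹ * ((2 ^ P.d * β) ^ m * sNorm g))) :=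
        mul_le_mul_of_nonneg_left (by linarith) (inv_nonneg.2 hm.le)
    _ = (2 ^ P.d * β) ^ m * ((P.mesh 0)⁻¹ * (2 * ((Real.sqrt (P.mesh 0 ^ P.d))⁻¹ * msq⁻¹ * sNorm g))) := by ring

/-- «so the series in the representation (2.12) is convergent»: a geometric tail bound yields the remainder hypothesis — if `Φ_m ≤ ρ^m·C` with
`0 ≤ C`, `0 ≤ ρ < 1`, then `Φ_m ≤ ε′` for some `m`. [cite: Balaban1983RegularityDecay, (2.12) p.577] -/
theorem exists_le_of_geometric {Φ : ℕ → ℝ} {ρ Cst : ℝ} (hρ0 : 0 ≤ ρ) (hρ : ρ < 1) (hC : 0 ≤ Cst) (h : ∀ m, Φ m ≤ ρ ^ m * Cst)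
    (ε' : ℝ) (hε' : 0 < ε') : ∃ m : ℕ, Φ m ≤ ε' := by
  by_cases hC0 : Cst = 0
  · exact ⟨0, (h 0).trans (by rw [hC0, mul_zero]; exact hε'.le)⟩
  · have hCpos : 0 < Cst := lt_of_le_of_ne hC (Ne.symm hC0)
    obtain ⟨m, hm⟩ := exists_pow_lt_of_lt_one (div_pos hε' hCpos) hρ
    refine ⟨m, (h m).trans ?_⟩
    have := (lt_div_iff₀ hCpos).1 hm
    have : 0 ≤ ρ ^ m := pow_nonneg hρ0 m
    linarith

/-- **THE REMAINDER FOR THE DERIVATIVE PROBE**: `|D^ε_A((G1_Ω)(R1_Ω)^m f)(b)| → 0` (`2^dβ < 1`).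
[cite: Balaban1983RegularityDecay, (2.12) p.577] -/
theorem exists_deriv_tail_le (hK : K ≤ P.K) (hK₀ : K₀ ∣ P.M) (hK₀8 : 8 ≤ K₀) (hmsq : 0 < msq) (hak : 0 ≤ B1.aSeq a P.L K)
    {β : ℝ} (hβ : 0 ≤ β) (hsmall : 2 ^ P.d * β < 1)
    (hb : ∀ (j : Lab P K K₀) (φ : HiggsLattice.ScalarField P 0 N), (∀ x, x ∉ Ω → φ x = 0) →
      sNorm (bOp C K K₀ Ω A msq a j φ) ≤ β * sNorm φ)
    (g : HiggsLattice.ScalarField P 0 N) (b : HiggsLattice.PBond P 0) :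
    ∀ ε' : ℝ, 0 < ε' → ∃ m : ℕ, ‖covDeriv C A ((GP C K Ω A msq a * RopP C K K₀ Ω A msq a ^ m) g) b‖ ≤ ε' := by
  have hC0 : 0 ≤ (P.mesh 0)⁻¹ * (2 * ((Real.sqrt (P.mesh 0 ^ P.d))⁻¹ * msq⁻¹ * sNorm g)) := by
    have := Real.sqrt_nonneg (P.mesh 0 ^ P.d)
    have := sNorm_nonneg g
    have := P.mesh_pos 0
    positivity
  exact exists_le_of_geometric (Φ := fun m => ‖covDeriv C A ((GP C K Ω A msq a * RopP C K K₀ Ω A msq a ^ m) g) b‖)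
    (by positivity) hsmall hC0 (norm_covDeriv_tail_le C Ω A hK hK₀ hK₀8 hmsq hak hβ hb · g b)

set_option maxHeartbeats 400000 in
/-- **THE (2.17) LETTERS AT A CUBE UNDER (2.23) ON THAT CUBE**: `‖G_K(□_j, Ã_j)(h_jψ)‖_∞ ≤ C_γ(L^Kε)²‖ψ‖_∞`,
`‖D^ε_{Ã_j}G_K(□_j, Ã_j)(h_jψ)(b)‖ ≤ C_δ(L^Kε)‖ψ‖_∞` on the bonds of `□_j`, and `‖D^ε_A(h_jG_K(□_j, Ã_j)(h_jψ))‖_∞ ≤ C_T(L^Kε)‖ψ‖_∞` — gen 11's `cube_inputs_reg` (value, derivative, Leibniz with «|∂^ηh_j| ≤ O(M⁻¹)») with the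
regularity hypothesis read on the sites of `□_j` only. [cite: Balaban1983RegularityDecay, Lemma 2.2 (2.17) p.578, (2.13) p.577]
[cite: Balaban1982Higgs1, Prop. 2.1 (2.23) p.610] -/
theorem cube_deriv_sup (C : ChargeData N) (d0 ℓ0 : ℕ) (hℓ0 : 1 ≤ ℓ0) {a : ℝ} (ha : 0 < a) {msq : ℝ} (hmsq : 0 < msq) (m2plus : ℝ)
    (creg β : ℝ) (hcreg : 0 ≤ creg) (hβ : 0 < β) :
    ∃ Cγ Cδ CT : ℝ, 0 < Cγ ∧ 0 < Cδ ∧ 0 < CT ∧ ∀ K₀ : ℕ, 8 ≤ K₀ → ∃ e₁ : ℝ, 0 < e₁ ∧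
      ∀ (P : HiggsLattice.Params), dd P = d0 → P.L - 1 = ℓ0 → ∀ {K : ℕ}, 1 ≤ K → K ≤ P.K → K₀ ∣ P.M →
      (∀ μ, 3 * half P K K₀ ≤ P.sitesPerDir 0 μ) → msq * P.mesh K ^ 2 ≤ m2plus →
      ∀ (j : Lab P K K₀) (A : HiggsLattice.VecField P 0) {ec : ℝ}, 0 < ec → ec ≤ e₁ →
      (∀ x ∈ cube K K₀ j, ∀ μ ν : Fin P.d,
          P.mesh K * |C.e| / ec * |A ⟨x.shift μ, ν⟩ - A ⟨x, ν⟩| ≤ creg * ec ^ (β - 1) / (P.L : ℝ) ^ K) →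
        (∀ ψ : HiggsLattice.ScalarField P 0 N,
            ‖propagatorK C (cube K K₀ j) (cubeVec K K₀ j A) msq a K (hTor K K₀ j • ψ)‖ ≤ Cγ * P.mesh K ^ 2 * ‖ψ‖) ∧
        (∀ (ψ : HiggsLattice.ScalarField P 0 N) (x : HiggsLattice.Site P 0) (μ : Fin P.d), x ∈ cube K K₀ j → x.shift μ ∈ cube K K₀ j →
            ‖covDeriv C (cubeVec K K₀ j A) (propagatorK C (cube K K₀ j) (cubeVec K K₀ j A) msq a K (hTor K K₀ j • ψ)) ⟨x, μ⟩‖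
              ≤ Cδ * P.mesh K * ‖ψ‖) ∧
        (∀ ψ : HiggsLattice.ScalarField P 0 N,
            ‖(fun b => covDeriv C A (hTor K K₀ j • propagatorK C (cube K K₀ j) (cubeVec K K₀ j A) msq a K (hTor K K₀ j • ψ)) b :
              HiggsLattice.PBond P 0 → EuclideanSpace ℝ (Fin N))‖ ≤ CT * P.mesh K * ‖ψ‖) := by
  obtain ⟨Cγ, Cβ, hCγ, hCβ, hci⟩ := cube_inputs C d0 ℓ0 hℓ0 a a m2plus ha
  obtain ⟨Cδ, hCδ, hdi⟩ := cube_input_deriv C d0 ℓ0 hℓ0 a a m2plus ha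
  have hD1 := D1_nonneg contDiff_hprof hasCompactSupport_hprof
  have hD2 := D2_nonneg contDiff_hprof hasCompactSupport_hprof
  refine ⟨Cγ, Cδ, Cδ + ((d0 : ℝ) + 1) * (D1 hprof + D2 hprof) / 8 * Cγ, hCγ, hCδ, by positivity, fun K₀ hK₀8 => ?_⟩
  obtain ⟨e₁, he₁, hthr⟩ := hci creg β hcreg hβ K₀ hK₀8
  obtain ⟨e₂, he₂, hdthr⟩ := hdi creg β hcreg hβ K₀ hK₀8
  refine ⟨min e₁ e₂, lt_min he₁ he₂, ?_⟩
  intro P hPd hPL K hK1 hK hK₀M hN3 hcap j A ec hec hle hreg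
  have hec1 : ec ≤ e₁ := hle.trans (min_le_left _ _)
  have hec2 : ec ≤ e₂ := hle.trans (min_le_right _ _)
  have hmesh : 0 < P.mesh K := P.mesh_pos K
  have hK₀' : 1 ≤ K₀ := le_trans (by norm_num) hK₀8
  have hK₀r : (0 : ℝ) < K₀ := by exact_mod_cast hK₀'
  have h17 := abs_acT_sub_le_of_reg_on hK hK₀M hK₀' C j A hec hreg
  have hGK := hthr P hPd hPL K hK1 hK hK₀M hN3 a msq le_rfl le_rfl hmsq hcap j A ec hec hec1 h17
  have hDD := hdthr P hPd hPL K hK1 hK hK₀M hN3 a msq le_rfl le_rfl hmsq hcap j A ec hec hec2 h17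
  refine ⟨hGK.1, hDD, fun ψ => ?_⟩
  have hψ0 : 0 ≤ ‖ψ‖ := norm_nonneg _
  have hu : ∀ x, ‖propagatorK C (cube K K₀ j) (cubeVec K K₀ j A) msq a K (hTor K K₀ j • ψ) x‖ ≤ Cγ * P.mesh K ^ 2 * ‖ψ‖ :=
    fun x => (norm_le_pi_norm _ x).trans (hGK.1 ψ)
  have hmain := norm_covDeriv_hsmul_le C hK hK₀M hK₀8 hN3 j A
    (propagatorK C (cube K K₀ j) (cubeVec K K₀ j A) msq a K (hTor K K₀ j • ψ)) (γD := Cδ * P.mesh K * ‖ψ‖)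
    (γ0 := Cγ * P.mesh K ^ 2 * ‖ψ‖) (by positivity) (by positivity) (fun x μ hx hs => hDD ψ x μ hx hs) hu
  refine hmain.trans ?_
  subst hPd
  have h8 : ((dd P : ℝ) + 1) * (D1 hprof + D2 hprof) / K₀ ≤ ((dd P : ℝ) + 1) * (D1 hprof + D2 hprof) / 8 :=
    div_le_div_of_nonneg_left (by positivity) (by norm_num) (by exact_mod_cast hK₀8)
  have e : ((dd P : ℝ) + 1) * (D1 hprof + D2 hprof) / K₀ * (P.mesh K)⁻¹ * (Cγ * P.mesh K ^ 2 * ‖ψ‖)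
      = ((dd P : ℝ) + 1) * (D1 hprof + D2 hprof) / K₀ * (Cγ * P.mesh K * ‖ψ‖) := by
    field_simp
  rw [e]
  calc Cδ * P.mesh K * ‖ψ‖ + ((dd P : ℝ) + 1) * (D1 hprof + D2 hprof) / K₀ * (Cγ * P.mesh K * ‖ψ‖)
      ≤ Cδ * P.mesh K * ‖ψ‖ + ((dd P : ℝ) + 1) * (D1 hprof + D2 hprof) / 8 * (Cγ * P.mesh K * ‖ψ‖) := by
        gcongr
    _ = (Cδ + ((dd P : ℝ) + 1) * (D1 hprof + D2 hprof) / 8 * Cγ) * P.mesh K * ‖ψ‖ := by ring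

end DerivProbe

/-! ## §3 Prop. 2.1 (2.25), derivative member, for big-block regions under `R₀` at every (2.23)-regular field -/

section Main

set_option maxHeartbeats 800000 in
/-- **PROP. 2.1 (2.25), DERIVATIVE MEMBER, FOR BIG-BLOCK REGIONS `Ω ⊂ T_ε` UNDER `R₀`, AT EVERY (2.23)-REGULAR VECTOR FIELD — B4's THEOREM (1.10)
DERIVATIVE MEMBER FOR REGIONS ON THE CARRIER.**  Same data as the value member (`B1Ineq225RegularRegion.norm_propagatorK_region_reg_decay`), `R₀` enlarged by
one lattice step (`{|y − x| ≤ 2rS + 2M(d+1) + 1} ⊂ Ω`, so that both end points of the bond see interior cubes only); for `g` supported in a `K`-block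
with `‖g‖_∞ ≤ M′` vanishing at the sites within distance `< D` of `x`: `‖(D^ε_A G^ε_K(Ω, A)1_Ωg)(⟨x, μ⟩)‖ ≤ c₁(L^Kε)·exp(−D/(2K₀L^K))·M′`
(`c₁ = 2·(2·2^d)·C_T·e²`).  Proof = `chain_region_of_inputs_probe` with the derivative probe at `X₀ = {x, x + e_μ}`, letters as in the value member,
`Φ(a_ig) ≤ C_T(L^Kε)‖g‖_∞` from `cube_deriv_sup`.
[cite: Balaban1982Higgs1, Prop. 2.1 (2.23), (2.25) p.610] [cite: Balaban1983RegularityDecay, Theorem (1.10) p.572; (2.18)–(2.22) pp.578–579] -/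
theorem norm_covDeriv_propagatorK_region_reg_decay (d L : ℕ) (hd : 1 ≤ d) (hL : 2 ≤ L) {a : ℝ} (ha : 0 < a) {msq : ℝ} (hmsq : 0 < msq)
    (N : ℕ) (C : ChargeData N) (ε₀ : ℝ) (creg β : ℝ) (hcreg : 0 ≤ creg) (hβ : 0 < β) :
    ∃ c₀ : ℝ, 0 < c₀ ∧ ∃ K₀min : ℕ, ∀ K₀ : ℕ, K₀min ≤ K₀ → ∃ e₁ : ℝ, 0 < e₁ ∧
      ∀ (P : HiggsLattice.Params), P.d = d → P.L = L → K₀ ∣ P.M →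
      ∀ {K : ℕ}, 1 ≤ K → K ≤ P.K → (∀ μ, 3 * half P K K₀ ≤ P.sitesPerDir 0 μ) → P.mesh K ≤ ε₀ →
      ∀ (Ω : Finset (HiggsLattice.Site P 0)), IsBigBlockUnion K K₀ Ω →
      ∀ (A : HiggsLattice.VecField P 0) {ec : ℝ}, 0 < ec → ec ≤ e₁ →
      (∀ z ∈ Ω, ∀ μ ν : Fin P.d,
          P.mesh K * |C.e| / ec * |A ⟨z.shift μ, ν⟩ - A ⟨z, ν⟩| ≤ creg * ec ^ (β - 1) / (P.L : ℝ) ^ K) →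
      ∀ (x : HiggsLattice.Site P 0) (μ : Fin P.d),
        (∀ y, HiggsLattice.Site.tdist x y ≤ 2 * rS P K K₀ + 2 * half P K K₀ * (P.d + 1) + 1 → y ∈ Ω) →
        ∀ (y₀ : HiggsLattice.Site P 0) (g : HiggsLattice.ScalarField P 0 N) (M D : ℝ),
          (∀ y, blockIter K y ≠ blockIter K y₀ → g y = 0) → (∀ y, ‖g y‖ ≤ M) → 0 ≤ D →
          (∀ z, g z ≠ 0 → D ≤ (HiggsLattice.Site.tdist x z : ℝ)) →
            ‖covDeriv C A (propagatorK C Ω A msq a K (chi Ω • g)) ⟨x, μ⟩‖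
              ≤ c₀ * P.mesh K * Real.exp (-(D / (2 * K₀ * (P.L : ℝ) ^ K))) * M := by
  have hℓ0 : 1 ≤ L - 1 := by omega
  have hp₁ : (((d - 1 : ℕ)) : ℝ) + 1 < 2 * d := by
    rw [Nat.cast_sub hd, Nat.cast_one]
    have : (1 : ℝ) ≤ d := by exact_mod_cast hd
    linarith
  obtain ⟨Cγ, Cβ, hCγ, hCβ, hcube⟩ := cube_inputs_lp C (d - 1) (L - 1) hℓ0 a a (msq * ε₀ ^ 2) ha hp₁
  obtain ⟨Cγ', Cδ, CT, hCγ', hCδ, hCT, hderiv⟩ := cube_deriv_sup C (d - 1) (L - 1) hℓ0 ha hmsq (msq * ε₀ ^ 2) creg β hcreg hβ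
  -- the boundary-piece constant of Lemma 2.1 (depends on `d, L, a` only)
  have hLr : (1 : ℝ) < L := by exact_mod_cast (show 1 < L by omega)
  set γ₀ : ℝ := min 2 (a * (1 - (((L : ℕ) : ℝ) ^ 2)⁻¹) / 4) with hγ₀
  have hγ₀pos : 0 < γ₀ := by
    have h1 : (((L : ℕ) : ℝ) ^ 2)⁻¹ < 1 := inv_lt_one_of_one_lt₀ (by nlinarith)
    exact lt_min (by norm_num) (by nlinarith [mul_pos ha (show (0 : ℝ) < 1 - (((L : ℕ) : ℝ) ^ 2)⁻¹ by linarith)])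
  set Cb : ℝ := ((((d - 1 : ℕ)) : ℝ) + 1) * (D1 hprof + D2 hprof) * (γ₀⁻¹ + 2 * Real.sqrt (d * γ₀⁻¹) + a * γ₀⁻¹) with hCb
  have hD1 := D1_nonneg contDiff_hprof hasCompactSupport_hprof
  have hD2 := D2_nonneg contDiff_hprof hasCompactSupport_hprof
  have hCb0 : 0 ≤ Cb := by
    have := inv_nonneg.2 hγ₀pos.le
    have := Real.sqrt_nonneg (d * γ₀⁻¹)
    positivity
  set Cm : ℝ := max Cβ Cb with hCm
  have hCm0 : 0 < Cm := lt_of_lt_of_le hCβ (le_max_left _ _)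
  refine ⟨2 * (2 * 2 ^ d) * CT * Real.exp 2, by positivity, max 8 ⌈(3 : ℝ) ^ d * Cm * Real.exp 1⌉₊, fun K₀ hK₀ => ?_⟩
  have hK₀8 : 8 ≤ K₀ := le_trans (le_max_left _ _) hK₀
  have hK₀r : (0 : ℝ) < K₀ := by exact_mod_cast lt_of_lt_of_le (by norm_num) hK₀8
  have hK₀C : (3 : ℝ) ^ d * Cm * Real.exp 1 ≤ K₀ :=
    (Nat.le_ceil _).trans (by exact_mod_cast le_trans (le_max_right _ _) hK₀)
  obtain ⟨e₁, he₁, hcubeK⟩ := hcube creg β hcreg hβ K₀ hK₀8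
  obtain ⟨e₃, he₃, hderK⟩ := hderiv K₀ hK₀8
  -- the smallness of `e_K` for Lemma 2.1 at the boundary pieces: `d²·c·e_K^β ≤ 1/3`
  set es : ℝ := ((3 * ((d : ℝ) ^ 2 * creg + 1))⁻¹) ^ β⁻¹ with hes
  have hin : 0 < (3 * ((d : ℝ) ^ 2 * creg + 1))⁻¹ := by positivity
  have hes0 : 0 < es := Real.rpow_pos_of_pos hin _
  refine ⟨min (min e₁ es) e₃, lt_min (lt_min he₁ hes0) he₃, ?_⟩
  intro P hPd hPL hK₀M K hK1 hK hN3 hε Ω hΩ A ec hec hle' hreg x μ hR' y₀ g M D hg hgM hD0 hD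
  have hle : ec ≤ min e₁ es := hle'.trans (min_le_left _ _)
  have hle3 : ec ≤ e₃ := hle'.trans (min_le_right _ _)
  -- `R₀` around both end points of the bond
  have hR : ∀ x' ∈ ({x, x.shift μ} : Finset (HiggsLattice.Site P 0)), ∀ y,
      HiggsLattice.Site.tdist x' y ≤ 2 * rS P K K₀ + 2 * half P K K₀ * (P.d + 1) → y ∈ Ω := by
    intro x' hx' y hy
    simp only [Finset.mem_insert, Finset.mem_singleton] at hx'
    rcases hx' with h | h
    · subst h; exact hR' y (by omega)
    · subst h
      apply hR' y
      have h1 := tdist_shift_le_one x μ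
      have h2 : (HiggsLattice.Site.tdist x y : ℝ) ≤ HiggsLattice.Site.tdist x (x.shift μ) + HiggsLattice.Site.tdist (x.shift μ) y :=
        tdist_triangle_real _ _ _
      have h3 : HiggsLattice.Site.tdist x y ≤ HiggsLattice.Site.tdist x (x.shift μ) + HiggsLattice.Site.tdist (x.shift μ) y := by
        exact_mod_cast h2
      omega
  subst hPd
  have hdd : dd P = P.d - 1 := rfl
  have hPL1 : P.L - 1 = L - 1 := by rw [hPL]
  have hL1 : 1 < P.L := by rw [hPL]; omega
  have hL1r : (1 : ℝ) < P.L := by exact_mod_cast hL1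
  have hak : 0 ≤ B1.aSeq a P.L K := (B1.aSeq_pos ha hL1r hK1).le
  have hK₀' : 1 ≤ K₀ := le_trans (by norm_num) hK₀8
  have hmesh : 0 < P.mesh K := P.mesh_pos K
  have hcap : msq * P.mesh K ^ 2 ≤ msq * ε₀ ^ 2 := mul_le_mul_of_nonneg_left (pow_le_pow_left₀ hmesh.le hε 2) hmsq.le
  have hM0 : 0 ≤ M := (norm_nonneg _).trans (hgM x)
  have hgn : ‖g‖ ≤ M := (pi_norm_le_iff_of_nonneg hM0).2 hgM
  -- the letter constant and its smallness
  set βK : ℝ := Cm / K₀ with hβK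
  have hβK0 : 0 ≤ βK := div_nonneg hCm0.le hK₀r.le
  have hCβK : Cβ / K₀ ≤ βK := div_le_div_of_nonneg_right (le_max_left _ _) hK₀r.le
  have hCbK : Cb / K₀ ≤ βK := div_le_div_of_nonneg_right (le_max_right _ _) hK₀r.le
  have hDβ : (3 : ℝ) ^ P.d * βK ≤ Real.exp (-1) := by
    rw [hβK, mul_div_assoc', div_le_iff₀ hK₀r]
    have h1 : Real.exp (-1) * Real.exp 1 = 1 := by rw [← Real.exp_add]; norm_num
    have h2 : (3 : ℝ) ^ P.d * Cm = (3 : ℝ) ^ P.d * Cm * Real.exp 1 * Real.exp (-1) := by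
      rw [mul_assoc ((3 : ℝ) ^ P.d * Cm), mul_comm (Real.exp 1), h1, mul_one]
    rw [h2]
    exact mul_le_mul_of_nonneg_right hK₀C (Real.exp_pos _).le |>.trans_eq (mul_comm _ _)
  -- the cube inputs at the interior cubes
  have hcj : ∀ j : Lab P K K₀, cube K K₀ j ⊆ Ω → _ := fun j hj =>
    hcubeK P hdd hPL1 K hK1 hK hK₀M hN3 a msq le_rfl le_rfl hmsq hcap j A ec hec (hle.trans (min_le_left _ _))
      (abs_acT_sub_le_of_reg_on hK hK₀M hK₀' C j A hec fun z hz μ ν => hreg z (hj hz) μ ν)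
  have hdj : ∀ j : Lab P K K₀, cube K K₀ j ⊆ Ω → _ := fun j hj =>
    hderK P hdd hPL1 hK1 hK hK₀M hN3 hcap j A hec hle3 fun z hz μ' ν => hreg z (hj hz) μ' ν
  -- the smallness `d²·c·e_K^β ≤ 1/3`
  have hsmall : (P.d : ℝ) ^ 2 * creg * ec ^ β ≤ 1 / 3 := by
    have h1 : ec ^ β ≤ es ^ β := Real.rpow_le_rpow hec.le (hle.trans (min_le_right _ _)) hβ.le
    have h2 : es ^ β = (3 * ((P.d : ℝ) ^ 2 * creg + 1))⁻¹ := by rw [hes, Real.rpow_inv_rpow hin.le hβ.ne']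
    rw [h2] at h1
    have h3 : (P.d : ℝ) ^ 2 * creg * ec ^ β ≤ (P.d : ℝ) ^ 2 * creg * (3 * ((P.d : ℝ) ^ 2 * creg + 1))⁻¹ :=
      mul_le_mul_of_nonneg_left h1 (by positivity)
    refine h3.trans ?_
    rw [← div_eq_mul_inv, div_le_div_iff₀ (by positivity) (by norm_num)]
    nlinarith [sq_nonneg (P.d : ℝ), mul_nonneg (sq_nonneg (P.d : ℝ)) hcreg]
  have hreg' : ∀ z ∈ Ω, ∀ μ ν : Fin P.d,
      P.mesh K * |C.e| / ec * |A ⟨z.shift ν, μ⟩ - A ⟨z, μ⟩| ≤ creg * ec ^ (β - 1) / (P.L : ℝ) ^ K :=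
    fun z hz μ ν => hreg z hz ν μ
  -- the `L²` letter at every piece
  have h2 : ∀ (j : Lab P K K₀) (ψ : HiggsLattice.ScalarField P 0 N), (∀ y, y ∉ Ω → ψ y = 0) →
      sNorm (bOp C K K₀ Ω A msq a j ψ) ≤ βK * sNorm ψ := by
    intro j ψ hψ
    by_cases hj : cube K K₀ j ⊆ Ω
    · -- interior cube: the (2, 2) letter of (2.21), transferred to the (1.5) norm
      have h22 := (hcj j hj).2.2.1 2 2 (by norm_num) le_rfl (by rw [sub_self]; positivity) ψ
      have hc := cTwo_pos P K
      rw [lpT_two_eq, lpT_two_eq, mul_left_comm (Cβ / (K₀ : ℝ))] at h22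
      have h3 := le_of_mul_le_mul_left h22 hc
      rw [bOp_of_good C Ω A msq a hj ψ, ← neg_one_smul ℝ, sNorm_smul, abs_neg, abs_one, one_mul]
      exact h3.trans (mul_le_mul_of_nonneg_right hCβK (sNorm_nonneg _))
    · -- boundary piece: Lemma 2.1
      have hb := sNorm_bOp_le_of_bad C ha hL1 hmsq hK1 hK hK₀M hK₀8 hN3 hΩ A hec hreg' hsmall hj ψ hψ
      refine hb.trans (mul_le_mul_of_nonneg_right (le_trans (le_of_eq ?_) hCbK) (sNorm_nonneg _))
      rw [hCb, hγ₀, hPL, hdd]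
  -- smallness for the remainder
  have h23 : (2 : ℝ) ^ P.d * βK < 1 := by
    have h1 : (2 : ℝ) ^ P.d ≤ 3 ^ P.d := pow_le_pow_left₀ (by norm_num) (by norm_num) _
    have h2 : Real.exp (-1) < 1 := Real.exp_lt_one_iff.2 (by norm_num)
    nlinarith [mul_le_mul_of_nonneg_right h1 hβK0]
  -- `f` vanishes within `⌈D⌉ − 1` of both end points
  have hfX : ∀ x' ∈ ({x, x.shift μ} : Finset (HiggsLattice.Site P 0)), ∀ y, g y ≠ 0 → ⌈D⌉₊ - 1 ≤ HiggsLattice.Site.tdist x' y := by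
    intro x' hx' y hy
    have hDy : ⌈D⌉₊ ≤ HiggsLattice.Site.tdist x y := Nat.ceil_le.2 (hD y hy)
    simp only [Finset.mem_insert, Finset.mem_singleton] at hx'
    rcases hx' with h | h
    · subst h; omega
    · subst h
      have h1 := tdist_shift_le_one x μ
      have h2 : (HiggsLattice.Site.tdist x y : ℝ) ≤ HiggsLattice.Site.tdist x (x.shift μ) + HiggsLattice.Site.tdist (x.shift μ) y :=
        tdist_triangle_real _ _ _
      have h3 : HiggsLattice.Site.tdist x y ≤ HiggsLattice.Site.tdist x (x.shift μ) + HiggsLattice.Site.tdist (x.shift μ) y := by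
        exact_mod_cast h2
      omega
  -- the chain with the derivative probe
  have hmain := chain_region_of_inputs_probe C Ω A hK hK₀M hK₀8 hN3 hΩ hmsq hak (n₀ := P.d) P.hd
    (γ := CT * P.mesh K) (β := βK) (by positivity) hβK0 hDβ
    (Φ := fun w => ‖covDeriv C A w ⟨x, μ⟩‖) (by simp [covDeriv_zero'])
    (fun u v => by simp only [covDeriv_add']; exact norm_add_le _ _)
    ({x, x.shift μ} : Finset (HiggsLattice.Site P 0))
    (fun i hi g' => by
      have hx1 : ¬ Near K K₀ (rS P K K₀) i x := hi x (by simp)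
      have hx2 : ¬ Near K K₀ (rS P K K₀) i (x.shift μ) := hi (x.shift μ) (by simp)
      simp only [covDeriv_aOp_eq_zero C Ω A hK hK₀M hK₀8 i g' hx1 hx2, norm_zero, le_refl])
    (fun i hi g' => by
      show ‖covDeriv C A (aOp C K K₀ Ω A msq a i g') ⟨x, μ⟩‖ ≤ CT * P.mesh K * ‖g'‖
      rw [aOp_apply, Gloc_of_good C Ω A msq a hi]
      exact (norm_le_pi_norm (fun b => covDeriv C A (hTor K K₀ i • propagatorK C (cube K K₀ i) (cubeVec K K₀ i A) msq a K
        (hTor K K₀ i • g')) b : HiggsLattice.PBond P 0 → EuclideanSpace ℝ (Fin N)) ⟨x, μ⟩).trans ((hdj i hi).2.2 g'))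
    (fun j hj ψ => by
      rw [bOp_of_good C Ω A msq a hj ψ, norm_neg]
      exact ((hcj j hj).2.1 ψ).trans (mul_le_mul_of_nonneg_right hCβK (norm_nonneg _)))
    (fun j hj p q h1p hpq hdiff ψ => by
      rw [bOp_of_good C Ω A msq a hj ψ, lpT_neg]
      exact ((hcj j hj).2.2.1 p q h1p hpq hdiff ψ).trans (mul_le_mul_of_nonneg_right hCβK (lpT_nonneg _ _)))
    (fun j hj ψ => by
      rw [bOp_of_good C Ω A msq a hj ψ, norm_neg]
      exact ((hcj j hj).2.2.2 (2 * P.d) le_rfl ψ).trans (mul_le_mul_of_nonneg_right hCβK (lpT_nonneg _ _)))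
    h2 hR g (Dist := ⌈D⌉₊ - 1) hfX (V := 1) le_rfl
    (by rw [one_mul]; exact lpT_two_le_of_blockK hK y₀ hg)
    (exists_deriv_tail_le C Ω A hK hK₀M hK₀8 hmsq hak hβK0 h23 h2 g ⟨x, μ⟩)
  refine hmain.trans ?_
  -- the exponent: `(⌈D⌉ − 1 − 4rS)/(2M) ≥ D/(2K₀L^K) − 2`
  have hh : (half P K K₀ : ℝ) = (P.L : ℝ) ^ K * K₀ := by unfold half; push_cast; ring
  have hhpos : (0 : ℝ) < half P K K₀ := by exact_mod_cast half_pos hK₀'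
  have hh1 : (1 : ℝ) ≤ half P K K₀ := by exact_mod_cast half_pos hK₀'
  have hrS := rS_le_real (P := P) (K := K) hK₀8
  have hcard : (({x, x.shift μ} : Finset (HiggsLattice.Site P 0)).card : ℝ) ≤ 2 := by
    exact_mod_cast (Finset.card_insert_le _ _).trans (by rw [Finset.card_singleton])
  have hDist : D - 1 ≤ (((⌈D⌉₊ - 1 : ℕ)) : ℝ) := by
    have hDc : D ≤ (⌈D⌉₊ : ℝ) := Nat.le_ceil D
    rcases Nat.eq_zero_or_pos ⌈D⌉₊ with h0 | hpos
    · rw [h0]; simp; linarith [show (⌈D⌉₊ : ℝ) = 0 by exact_mod_cast h0]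
    · rw [Nat.cast_sub hpos, Nat.cast_one]; linarith
  have hexp : Real.exp (-(((((⌈D⌉₊ - 1 : ℕ)) : ℝ) - 4 * rS P K K₀) / (2 * half P K K₀)))
      ≤ Real.exp 2 * Real.exp (-(D / (2 * K₀ * (P.L : ℝ) ^ K))) := by
    rw [← Real.exp_add]
    refine Real.exp_le_exp.2 ?_
    have e1 : D / (2 * K₀ * (P.L : ℝ) ^ K) = D / (2 * half P K K₀) := by rw [hh]; ring_nf
    rw [e1]
    have h4 : (4 * (rS P K K₀ : ℝ)) + 1 ≤ 4 * half P K K₀ := by linarith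
    have e2 : ((((⌈D⌉₊ - 1 : ℕ)) : ℝ) - 4 * rS P K K₀) / (2 * half P K K₀) - D / (2 * half P K K₀)
        = ((((⌈D⌉₊ - 1 : ℕ)) : ℝ) - D - 4 * rS P K K₀) / (2 * half P K K₀) := by ring
    have h5 : -(2 : ℝ) ≤ ((((⌈D⌉₊ - 1 : ℕ)) : ℝ) - D - 4 * rS P K K₀) / (2 * half P K K₀) := by
      rw [le_div_iff₀ (by positivity)]
      linarith
    linarith
  calc 2 * ((({x, x.shift μ} : Finset (HiggsLattice.Site P 0)).card : ℝ) * 2 ^ P.d) * (CT * P.mesh K) * 1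
        * Real.exp (-(((((⌈D⌉₊ - 1 : ℕ)) : ℝ) - 4 * rS P K K₀) / (2 * half P K K₀))) * ‖g‖
      ≤ 2 * (2 * 2 ^ P.d) * (CT * P.mesh K) * 1 * (Real.exp 2 * Real.exp (-(D / (2 * K₀ * (P.L : ℝ) ^ K)))) * M := by
        refine mul_le_mul (mul_le_mul ?_ hexp (by positivity) (by positivity)) hgn (norm_nonneg _) (by positivity)
        have h1 : (({x, x.shift μ} : Finset (HiggsLattice.Site P 0)).card : ℝ) * 2 ^ P.d ≤ 2 * 2 ^ P.d :=
          mul_le_mul_of_nonneg_right hcard (by positivity)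
        have h2 : 2 * ((({x, x.shift μ} : Finset (HiggsLattice.Site P 0)).card : ℝ) * 2 ^ P.d) ≤ 2 * (2 * 2 ^ P.d) :=
          mul_le_mul_of_nonneg_left h1 (by norm_num)
        exact mul_le_mul_of_nonneg_right (mul_le_mul_of_nonneg_right h2 (by positivity)) zero_le_one
    _ = 2 * (2 * 2 ^ P.d) * CT * Real.exp 2 * P.mesh K * Real.exp (-(D / (2 * K₀ * (P.L : ℝ) ^ K))) * M := by ring

end Main

/-! ## §4 Summation over the `K`-blocks: arbitrary `g` -/

section Sum

variable {K : ℕ}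

set_option maxHeartbeats 800000 in
/-- **PROP. 2.1 (2.25), DERIVATIVE MEMBER, FOR BIG-BLOCK REGIONS UNDER `R₀` AT EVERY (2.23)-REGULAR FIELD, ARBITRARY `g`** — B4's THEOREM
(1.10) DERIVATIVE MEMBER FOR REGIONS ON THE CARRIER in the operator form of gens 10–11: same data as `norm_covDeriv_propagatorK_region_reg_decay`; constants `K₀min` and, for
every `K₀ ≥ K₀min`, `c₀(K₀), e₁(K₀) > 0` such that … for EVERY `g` with `‖g‖_∞ ≤ M′` vanishing at the sites within distance `< D` of `x`:
`‖(D^ε_A G^ε_K(Ω, A)1_Ωg)(⟨x, μ⟩)‖ ≤ c₁(K₀)(L^Kε)·exp(−D/(4K₀L^K))·M′`.  Proof: `g = Σ_b g|_{B^K(b)}` over the sites `b` of `T^{(K)}`; each piece is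
within the previous theorem with `D_b = max(D, L^K(|x_K − b| − 1))` (r14's `tdist_blockIter_le_real`), `e^{−D_b/(2K₀L^K)} ≤
e^{−D/(4K₀L^K)}e^{1/(4K₀)}e^{−|x_K − b|/(4K₀)}`, and `Σ_b e^{−|x_K − b|/(4K₀)} ≤ K_d(1/(4K₀))` uniformly on `T^{(K)}`.
[cite: Balaban1982Higgs1, Prop. 2.1 (2.23), (2.25) p.610] [cite: Balaban1983RegularityDecay, Theorem (1.10) p.572; (2.21)–(2.22) pp.578–579] -/
theorem norm_covDeriv_propagatorK_region_reg_decay_sum (d L : ℕ) (hd : 1 ≤ d) (hL : 2 ≤ L) {a : ℝ} (ha : 0 < a) {msq : ℝ} (hmsq : 0 < msq)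
    (N : ℕ) (C : ChargeData N) (ε₀ : ℝ) (creg β : ℝ) (hcreg : 0 ≤ creg) (hβ : 0 < β) :
    ∃ K₀min : ℕ, ∀ K₀ : ℕ, K₀min ≤ K₀ → ∃ c₀ e₁ : ℝ, 0 < c₀ ∧ 0 < e₁ ∧
      ∀ (P : HiggsLattice.Params), P.d = d → P.L = L → K₀ ∣ P.M →
      ∀ {K : ℕ}, 1 ≤ K → K ≤ P.K → (∀ μ, 3 * half P K K₀ ≤ P.sitesPerDir 0 μ) → P.mesh K ≤ ε₀ →
      ∀ (Ω : Finset (HiggsLattice.Site P 0)), IsBigBlockUnion K K₀ Ω →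
      ∀ (A : HiggsLattice.VecField P 0) {ec : ℝ}, 0 < ec → ec ≤ e₁ →
      (∀ z ∈ Ω, ∀ μ ν : Fin P.d,
          P.mesh K * |C.e| / ec * |A ⟨z.shift μ, ν⟩ - A ⟨z, ν⟩| ≤ creg * ec ^ (β - 1) / (P.L : ℝ) ^ K) →
      ∀ (x : HiggsLattice.Site P 0) (μ : Fin P.d),
        (∀ y, HiggsLattice.Site.tdist x y ≤ 2 * rS P K K₀ + 2 * half P K K₀ * (P.d + 1) + 1 → y ∈ Ω) →
        ∀ (g : HiggsLattice.ScalarField P 0 N) (M D : ℝ), (∀ y, ‖g y‖ ≤ M) → 0 ≤ D →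
          (∀ z, g z ≠ 0 → D ≤ (HiggsLattice.Site.tdist x z : ℝ)) →
            ‖covDeriv C A (propagatorK C Ω A msq a K (chi Ω • g)) ⟨x, μ⟩‖
              ≤ c₀ * P.mesh K * Real.exp (-(D / (4 * K₀ * (P.L : ℝ) ^ K))) * M := by
  obtain ⟨c₀, hc₀, K₀min, hmain⟩ := norm_covDeriv_propagatorK_region_reg_decay d L hd hL ha hmsq N C ε₀ creg β hcreg hβ
  refine ⟨max K₀min 1, fun K₀ hK₀ => ?_⟩
  have hK₀1 : 1 ≤ K₀ := le_trans (le_max_right _ _) hK₀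
  have hK₀r : (0 : ℝ) < K₀ := by exact_mod_cast hK₀1
  obtain ⟨e₁, he₁, hblk⟩ := hmain K₀ (le_trans (le_max_left _ _) hK₀)
  have hrate : (0 : ℝ) < 1 / (4 * K₀) := by positivity
  have hlc : 0 < latticeConst d (1 / (4 * K₀)) := by
    unfold latticeConst
    apply pow_pos
    have hdr : (0 : ℝ) < d := by exact_mod_cast hd
    have h1 : Real.exp (-(1 / (4 * (K₀ : ℝ)) / d)) < 1 := Real.exp_lt_one_iff.2 (by
      have := div_pos hrate hdr; linarith)
    have h2 : 0 < 1 - Real.exp (-(1 / (4 * (K₀ : ℝ)) / d)) := by linarith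
    positivity
  refine ⟨c₀ * Real.exp (1 / (4 * K₀)) * latticeConst d (1 / (4 * K₀)), e₁, by positivity, he₁, ?_⟩
  · intro P hPd hPL hK₀M K hK1 hK hN3 hε Ω hΩ A ec hec hle hreg x μ hR g M D hgM hD0 hD
    subst hPd
    have hmK0 : 0 < P.mesh K := P.mesh_pos K
    have hM0 : 0 ≤ M := (norm_nonneg _).trans (hgM x)
    have hLK : (0 : ℝ) < (P.L : ℝ) ^ K := pow_pos (by exact_mod_cast P.hL) K
    -- split `g` over the `K`-blocks
    have hsplit : covDeriv C A (propagatorK C Ω A msq a K (chi Ω • g)) ⟨x, μ⟩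
        = ∑ b : HiggsLattice.Site P K, covDeriv C A (propagatorK C Ω A msq a K (chi Ω • blockPiece K b g)) ⟨x, μ⟩ := by
      conv_lhs => rw [← sum_blockPiece (K := K) g]
      rw [Finset.smul_sum, map_sum, covDeriv_sum']
    rw [hsplit]
    refine (norm_sum_le _ _).trans ?_
    -- each block piece: the previous theorem with `D_b = max D (L^K(|x_K − b| − 1))`
    have hpiece : ∀ b : HiggsLattice.Site P K, ‖covDeriv C A (propagatorK C Ω A msq a K (chi Ω • blockPiece K b g)) ⟨x, μ⟩‖
        ≤ c₀ * P.mesh K * (Real.exp (-(D / (4 * K₀ * (P.L : ℝ) ^ K))) * Real.exp (1 / (4 * K₀))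
            * Real.exp (-(1 / (4 * K₀) * (HiggsLattice.Site.tdist (blockIter K x) b : ℝ)))) * M := by
      intro b
      classical
      by_cases hb : ∃ y₀, blockIter K y₀ = b
      · obtain ⟨y₀, hy₀⟩ := hb
        set Db : ℝ := max D ((P.L : ℝ) ^ K * ((HiggsLattice.Site.tdist (blockIter K x) b : ℝ) - 1)) with hDb
        have hDb0 : 0 ≤ Db := hD0.trans (le_max_left _ _)
        have hfar : ∀ z, blockPiece K b g z ≠ 0 → Db ≤ (HiggsLattice.Site.tdist x z : ℝ) := by
          intro z hz
          have hzb : blockIter K z = b := by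
            by_contra h
            exact hz (by unfold blockPiece; rw [if_neg h])
          have hgz : g z ≠ 0 := fun h0 => hz (by unfold blockPiece; rw [if_pos hzb, h0])
          refine max_le (hD z hgz) ?_
          have h1 := tdist_blockIter_le_real hK x z
          rw [hzb] at h1
          rw [mul_sub, mul_one, sub_le_iff_le_add]
          have h2 : (P.L : ℝ) ^ K * (HiggsLattice.Site.tdist (blockIter K x) b : ℝ)
              ≤ (P.L : ℝ) ^ K * ((HiggsLattice.Site.tdist x z : ℝ) / (P.L : ℝ) ^ K + 1 - ((P.L : ℝ) ^ K)⁻¹) :=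
            mul_le_mul_of_nonneg_left h1 hLK.le
          have e : (P.L : ℝ) ^ K * ((HiggsLattice.Site.tdist x z : ℝ) / (P.L : ℝ) ^ K + 1 - ((P.L : ℝ) ^ K)⁻¹)
              = (HiggsLattice.Site.tdist x z : ℝ) + (P.L : ℝ) ^ K - 1 := by field_simp
          rw [e] at h2
          linarith
        have h := hblk P rfl hPL hK₀M hK1 hK hN3 hε Ω hΩ A hec hle hreg x μ hR y₀ (blockPiece K b g) M Db
          (blockPiece_supported b g hy₀) (fun y => (norm_blockPiece_apply_le b g y).trans (hgM y)) hDb0 hfar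
        refine h.trans (mul_le_mul_of_nonneg_right (mul_le_mul_of_nonneg_left ?_ (by positivity)) hM0)
        -- `e^{−D_b/(2K₀L^K)} ≤ e^{−D/(4K₀L^K)}·e^{1/(4K₀)}·e^{−|x_K − b|/(4K₀)}`
        rw [← Real.exp_add, ← Real.exp_add]
        refine Real.exp_le_exp.2 ?_
        have hmax : D + (P.L : ℝ) ^ K * ((HiggsLattice.Site.tdist (blockIter K x) b : ℝ) - 1) ≤ 2 * Db :=
          by rw [two_mul]; exact add_le_add (le_max_left _ _) (le_max_right _ _)
        have hK4 : (0 : ℝ) < 4 * K₀ * (P.L : ℝ) ^ K := by positivity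
        have key : (D + (P.L : ℝ) ^ K * ((HiggsLattice.Site.tdist (blockIter K x) b : ℝ) - 1)) / (4 * K₀ * (P.L : ℝ) ^ K)
            ≤ Db / (2 * K₀ * (P.L : ℝ) ^ K) :=
          calc (D + (P.L : ℝ) ^ K * ((HiggsLattice.Site.tdist (blockIter K x) b : ℝ) - 1)) / (4 * K₀ * (P.L : ℝ) ^ K)
              ≤ 2 * Db / (4 * K₀ * (P.L : ℝ) ^ K) := div_le_div_of_nonneg_right hmax hK4.le
            _ = Db / (2 * K₀ * (P.L : ℝ) ^ K) := by field_simp; ring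
        have e1 : (D + (P.L : ℝ) ^ K * ((HiggsLattice.Site.tdist (blockIter K x) b : ℝ) - 1)) / (4 * K₀ * (P.L : ℝ) ^ K)
            = D / (4 * K₀ * (P.L : ℝ) ^ K) - 1 / (4 * K₀) + 1 / (4 * K₀) * (HiggsLattice.Site.tdist (blockIter K x) b : ℝ) := by
          field_simp
          ring
        rw [e1] at key
        linarith
      · -- no site maps to `b`: the piece vanishes
        have h0 : blockPiece K b g = 0 := by
          funext y
          unfold blockPiece
          rw [if_neg (fun h => hb ⟨y, h⟩)]
          rfl
        rw [h0, smul_zero, map_zero, covDeriv_zero', norm_zero]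
        positivity
    refine (Finset.sum_le_sum fun b _ => hpiece b).trans ?_
    rw [← Finset.sum_mul, ← Finset.mul_sum, ← Finset.mul_sum]
    have hsum := sum_exp_neg_tdist_le (P := P) (k := K) hrate (blockIter K x)
    have hmK := P.mesh_pos K
    calc c₀ * P.mesh K * (Real.exp (-(D / (4 * K₀ * (P.L : ℝ) ^ K))) * Real.exp (1 / (4 * K₀))
            * ∑ b : HiggsLattice.Site P K, Real.exp (-(1 / (4 * K₀) * (HiggsLattice.Site.tdist (blockIter K x) b : ℝ)))) * M
        ≤ c₀ * P.mesh K * (Real.exp (-(D / (4 * K₀ * (P.L : ℝ) ^ K))) * Real.exp (1 / (4 * K₀))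
            * latticeConst P.d (1 / (4 * K₀))) * M :=
          mul_le_mul_of_nonneg_right (mul_le_mul_of_nonneg_left (mul_le_mul_of_nonneg_left hsum (by positivity)) (by positivity)) hM0
      _ = c₀ * Real.exp (1 / (4 * K₀)) * latticeConst P.d (1 / (4 * K₀)) * P.mesh K
            * Real.exp (-(D / (4 * K₀ * (P.L : ℝ) ^ K))) * M := by ring

end Sum

end Literature.MathematicalPhysics.QuantumFieldTheory.Balaban1983to89.B1Ineq225DerivRegularRegion

end
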